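import Summits.CriticalPhenomena.PercolationContinuityZ3.Theorems.Transplant.CayleyMilnorGlide
import Summits.CriticalPhenomena.PercolationContinuityZ3.Theorems.Transplant.StatementHcp
import HarnessLib

/-!
# Milnor's kernel lemma, VII: the HEXAGONAL CLOSE PACKING is a customer of the one-type scaled node — `SamePDropOfSkeletonFrmScaled₁ →
# HcpOwnCriticalContinuity` through the `c`-glide `(a, b, z) ↦ (−b, −a, z + 1)`

builds on p205010 (kernel theorem, internal audit signed; external expert review pending) — nothing in this file uses p205010.  Every
percolation theorem here is CONDITIONAL on the OPEN node `SamePDropOfSkeletonFrmScaled₁` (hypothesis `hN`; nothing is claimed about it) and on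
NOTHING ELSE.  Lane `prim-bschramm`, seat `prim-bschramm-p4` gen 18 (PART C3 of `P4-GENERAL.md` §40).  Helper file
(`--supports stmt-CriticalPhenomena-4575`).

In the lane's integer model of the hexagonal close packing (`Hcp.hcpGraph`, seat p2, file `HcpNoConc`: A layers `x₂` even, B layers `x₂` odd, the
twelve contacts `Hcp.bonds`) the `c`-GLIDE `(a, b, z) ↦ (−b, −a, z + 1)` — the reflection of a layer in the line `ℝ(1,−1)` (it fixes the in-layer
hexagon and carries the three upper and the three lower contacts of an A site onto those of a B site, `Hcp.lam3_mem_bonds`, by `decide`) followed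
by the half period along `c` — is an automorphism exchanging the A and B layers (`Hcp.glide_adj_iff`); the horizontal translations are
automorphisms (`Hcp.translate_adj_iff`); the functional `ℓ(a, b) = a − b` is glide-invariant and nonzero.  So the screw/glide criterion of file VI
(`Glide3.criticalContinuity`) applies: **`Hcp.criticalContinuity_of_frmScaledNode₁ : U_s → ∀ v, θ_v(p_c(hcp)) = 0`** and
**`hcpOwnCriticalContinuity_of_frmScaledNode₁ : SamePDropOfSkeletonFrmScaled₁ → HcpOwnCriticalContinuity`** — TARGET 2t of the lane's class map,
typed `@[conjecture]` in `StatementHcp` and there recorded as outside every typed node (`Hcp.isEmpty_planarSkeletonConc_hcp` concerns the UNIT-RANGE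
point-group interface; the scaled frames-only interface needs neither a point symmetry nor unit steps of the bond set).  Group-theoretically: hcp
is a Cayley graph of the glide group `ℤ² ⋊_{lam} ℤ ≅ ℤ × (Klein-bottle group)`, which has `b₁ = 2`, whereas the screw group generated by the
translations and p2's layer swap `(i, j, z) ↦ (−i, −j, z + 1)` has `b₁ = 1`.
[cite: BenjaminiSchramm1996, Conj. 4 (p. 75); §2] [cite: ConwaySloane1999, Ch. 4 §6.1 (the hexagonal close packing)]
[cite: MilnorSolvableGrowth1968, Lemma 1] [cite: Hutchcroft2016, Thm. 1.1]
-/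

noncomputable section

namespace Summit.CriticalPhenomena.PercolationContinuityZ3.Theorems.Transplant

open SimpleGraph Literature.Probability.LatticeModels Literature.Probability.Percolation
open scoped Classical

/-! ## §5 The hexagonal close packing: the `c`-glide `(a, b, z) ↦ (−b, −a, z + 1)` -/

namespace Hcp

open Glide3

/-- The linear part of the `c`-glide on a layer: `(a, b) ↦ (−b, −a)` (reflection in the line `ℝ(1,−1)`; an involution).
[cite: ConwaySloane1999, Ch. 4 §6.1] -/
def lam : Site 2 ≃+ Site 2 where
  toFun v := ![-v 1, -v 0]
  invFun v := ![-v 1, -v 0]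
  left_inv v := by ext i; fin_cases i <;> simp
  right_inv v := by ext i; fin_cases i <;> simp
  map_add' v w := by ext i; fin_cases i <;> simp <;> ring

/-- `lam v = (−v₁, −v₀)`. [folklore] -/
@[simp] theorem lam_apply (v : Site 2) : lam v = ![-v 1, -v 0] := rfl

/-- The `c`-glide on `ℤ³`, spelled out: `(x₀, x₁, x₂) ↦ (−x₁, −x₀, x₂ + 1)`. [cite: ConwaySloane1999, Ch. 4 §6.1] -/
theorem glide_lam_eq (x : Site 3) : glide lam x = ![-x 1, -x 0, x 2 + 1] := by
  unfold glide Glide3.mk Glide3.pl; ext i; fin_cases i <;> simp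

/-- The linear part of the `c`-glide on `ℤ³`: `(x₀, x₁, x₂) ↦ (−x₁, −x₀, x₂)`. [folklore] -/
def lam3 (v : Site 3) : Site 3 := ![-v 1, -v 0, v 2]

/-- **The bond table under the glide's linear part**: the contacts of an A site go to the contacts of a B site and conversely.
[cite: ConwaySloane1999, Ch. 4 §6.1] -/
theorem lam3_mem_bonds : ∀ e : Bool, ∀ v ∈ bonds e, lam3 v ∈ bonds (!e) := by decide

/-- `lam3` is an involution. [folklore] -/
theorem lam3_lam3 (v : Site 3) : lam3 (lam3 v) = v := by
  ext i; fin_cases i <;> simp [lam3]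

/-- Differences under the glide are `lam3` of differences. [folklore] -/
theorem glide_sub (x y : Site 3) : glide lam y - glide lam x = lam3 (y - x) := by
  rw [glide_lam_eq, glide_lam_eq]
  ext i; fin_cases i <;> simp [lam3] <;> ring

/-- The glide exchanges A and B layers. [folklore] -/
theorem evenLayer_glide (x : Site 3) : evenLayer (glide lam x) = !evenLayer x := by
  rw [glide_lam_eq]
  unfold evenLayer
  simp only [Matrix.cons_val_two, Matrix.tail_cons, Matrix.head_cons]
  rcases Int.emod_two_eq_zero_or_one (x 2) with h | h
  · rw [h, show (x 2 + 1) % 2 = 1 by omega]; rfl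
  · rw [h, show (x 2 + 1) % 2 = 0 by omega]; rfl

/-- **The `c`-glide is an automorphism of hcp.** [cite: ConwaySloane1999, Ch. 4 §6.1] -/
theorem glide_adj_iff (x y : Site 3) : hcpGraph.Adj (glide lam x) (glide lam y) ↔ hcpGraph.Adj x y := by
  rw [hcp_adj_iff, hcp_adj_iff, glide_sub, evenLayer_glide]
  constructor
  · intro h
    have := lam3_mem_bonds _ _ h
    rwa [lam3_lam3, Bool.not_not] at this
  · intro h
    exact lam3_mem_bonds _ _ h

/-- Horizontal translations are automorphisms of hcp (they preserve the layer type). [cite: ConwaySloane1999, Ch. 4 §6.1] -/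
theorem translate_adj_iff (u : Site 2) (x y : Site 3) : hcpGraph.Adj (x + mk u 0) (y + mk u 0) ↔ hcpGraph.Adj x y := by
  rw [hcp_adj_iff, hcp_adj_iff, add_sub_add_right_eq_sub, add_comm x, evenLayer_add_even _ _ (by simp)]

/-- The glide-invariant functional `ℓ(a, b) = a − b` (the direction of the mirror line). [folklore] -/
def ell : Site 2 →+ ℤ where
  toFun v := v 0 - v 1
  map_zero' := by simp
  map_add' v w := by simp only [Pi.add_apply]; ring

/-- `ℓ ∘ lam = ℓ`. [folklore] -/
theorem ell_lam (v : Site 2) : ell (lam v) = ell v := by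
  show (![-v 1, -v 0] : Site 2) 0 - (![-v 1, -v 0] : Site 2) 1 = v 0 - v 1
  simp only [Matrix.cons_val_zero, Matrix.cons_val_one]
  ring

/-- `ℓ(1, 0) = 1 ≠ 0`. [folklore] -/
theorem ell_ne_zero : ell ![1, 0] ≠ 0 := by
  show (![(1 : ℤ), 0] : Site 2) 0 - (![(1 : ℤ), 0] : Site 2) 1 ≠ 0
  simp

/-- **THEOREM (modulo the scaled node ALONE): `θ_v(p_c(hcp)) = 0` at every vertex of the hexagonal close packing.**  The glide group
`ℤ² ⋊_{lam} ℤ` (horizontal translations and the `c`-glide) acts freely and transitively on hcp by automorphisms with the rank-2 character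
`(u, k) ↦ (u₀ − u₁, k)` — hcp is a Cayley graph of a group with `b₁ = 2` — so the screw/glide criterion applies.
[cite: BenjaminiSchramm1996, Conj. 4 (p. 75)] [cite: ConwaySloane1999, Ch. 4 §6.1] [cite: MilnorSolvableGrowth1968, Lemma 1] -/
theorem criticalContinuity_of_frmScaledNode₁ (hN : SamePDropOfSkeletonFrmScaled₁) (v : Site 3) :
    theta hcpGraph v (criticalProbIOf hcpGraph v) = 0 :=
  Glide3.criticalContinuity lam hN hcpGraph connected translate_adj_iff glide_adj_iff ell ell_lam _ ell_ne_zero v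

/-- … and `θ_v(p) = 0` on hcp for every `p ≤ p_c`. [cite: BenjaminiSchramm1996, Conj. 4 (p. 75)] -/
theorem theta_eq_zero_of_le_of_frmScaledNode₁ (hN : SamePDropOfSkeletonFrmScaled₁) (v : Site 3) {p : unitInterval}
    (hp : (p : ℝ) ≤ criticalProb hcpGraph v) : theta hcpGraph v p = 0 :=
  Glide3.theta_eq_zero_of_le lam hN hcpGraph connected translate_adj_iff glide_adj_iff ell ell_lam _ ell_ne_zero v hp

end Hcp

/-- **TARGET 2t modulo the scaled node**: `SamePDropOfSkeletonFrmScaled₁ → HcpOwnCriticalContinuity` — the hexagonal close packing, recorded in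
`StatementHcp` as outside every typed node of the lane, is a customer of the one-type scaled frames-only node through its `c`-glide.
[cite: BenjaminiSchramm1996, Conj. 4 (p. 75)] [cite: ConwaySloane1999, Ch. 4 §6.1] -/
theorem hcpOwnCriticalContinuity_of_frmScaledNode₁ (hN : SamePDropOfSkeletonFrmScaled₁) : HcpOwnCriticalContinuity :=
  fun v => Hcp.criticalContinuity_of_frmScaledNode₁ hN v

end Summit.CriticalPhenomena.PercolationContinuityZ3.Theorems.Transplant

end
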